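import Summits.FinalStateConjecture.FinalStateConjecture.Theorems.SwallowTheDatumKerrShieldedSettlesStubKerrExteriorDecompositionLateCharts
import HarnessLib

/-!
# `KerrShieldedSettles`, line `tapered-temporal-collar` — stub S6a, part D: deviations

Deviation of a chart with an `E4` representative; **zero deviation of the hole chart on the growing near
zone** (it is a Kerr–Schild time translation there), hence `truncDeviationCk ≡ 0` eventually for every
radius and along `nearR` (clause (i) of `HasExhaustiveCharts`); the flat chart's zero-extended deviation
equals, near every point of `U₀`, the explicit bent-gauge function of stub S6b, hence
`deviationCk → 0` on the flat slabs `{x⁰ = τ} ∩ U₀ ⊆ {r > √τ}` given S6b. References: DHRT arXiv:2104.08222 §1; O'Neill 1983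
Ch. 14 p. 402.
-/

set_option linter.dupNamespace false

noncomputable section

open Set Filter Topology
open scoped Manifold ContDiff Topology ENNReal
open Literature.Geometry.Lorentzian
open Summit.FinalStateConjecture.FinalStateConjecture.Theorems.KerrShieldedDataExist.Negative
  (bentHeight contDiff_bentHeight)

namespace Summit.FinalStateConjecture.FinalStateConjecture.Theorems.SwallowTheDatum.KerrShieldedSettles

namespace ExteriorDecomposition

section Deviation

variable [Kerr.Facts] {M a r₁ τ₀ : ℝ}

/-! ## Deviations of charts of the Kerr chart with an `E4` representative -/

/-- **Deviation through a representative.** For a chart `Ψ : U → Kerr.region a r₁` of the Kerr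
spacetime with `E4`-representative `Φ`, differentiable at `x`, the deviation from a background `B`
on `U` is `g_{M,a}(Φ x)(DΦ v, DΦ w) − g₀(x)(v, w)`. [folklore] -/
theorem deviation_of_repr (hM : 0 ≤ M) (B : ModelBackground) (Ψ : B.domain → Kerr.region a r₁)
    (Φ : E4 → E4) (hΦ : ∀ y : B.domain, (Ψ y : E4) = Φ y) (x : B.domain) (hd : DifferentiableAt ℝ Φ x)
    (v w : E4) :
    (Kerr.spacetime M a r₁ hM).deviation B Ψ x v w =
      Kerr.bilin M a (Φ x) (fderiv ℝ Φ x v) (fderiv ℝ Φ x w) - B.bilin x.1 v w := by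
  have hm : mfderiv 𝓘(ℝ, E4) 𝓘(ℝ, E4) Ψ x = fderiv ℝ Φ x := mfderiv_of_repr Ψ Φ hΦ x hd
  change Kerr.bilin M a (Ψ x : E4) (mfderiv 𝓘(ℝ, E4) 𝓘(ℝ, E4) Ψ x v)
    (mfderiv 𝓘(ℝ, E4) 𝓘(ℝ, E4) Ψ x w) - B.bilin x.1 v w = _
  rw [hm, hΦ x]
  rfl

/-! ## The hole chart: zero deviation on the growing near zone -/

/-- On the late near zone `{τ₀ < x⁰, r < 2R(x⁰)}` the (zero-extended) deviation of the hole chart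
from the Kerr background vanishes identically near the point (the chart is a Kerr–Schild time
translation there, an isometry of `g_{M,a}`). [folklore] -/
theorem deviationExtend_holeChart_eventuallyEq_zero (ha : |a| < M) (hM : 0 ≤ M) (hτ₀ : 1 ≤ τ₀)
    (h : r₁ ≤ Kerr.rPlus M a) {x : E4} (hx : x ∈ Kerr.exterior M a) (hx0 : τ₀ < x 0)
    (hxr : Kerr.radius a x < 2 * nearR (x 0)) :
    (Kerr.spacetime M a r₁ hM).deviationExtend (Kerr.background M a) (holeChart M a r₁ τ₀ h)
      =ᶠ[𝓝 x] 0 := by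
  -- the near zone is open
  have h0c : Continuous fun y : E4 ↦ y 0 := PiLp.continuous_apply 2 _ 0
  have hRc : Continuous fun y : E4 ↦ 2 * nearR (y 0) :=
    continuous_const.mul ((Real.continuous_sqrt.add continuous_const).comp h0c)
  have hN : IsOpen {y : E4 | y ∈ Kerr.exterior M a ∧ τ₀ < y 0 ∧ Kerr.radius a y < 2 * nearR (y 0)} :=
    (Kerr.exterior M a).2.inter ((isOpen_lt continuous_const h0c).inter
      (isOpen_lt (Kerr.continuous_radius a) hRc))
  filter_upwards [hN.mem_nhds ⟨hx, hx0, hxr⟩] with y hy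
  obtain ⟨hyU, hy0, hyr⟩ := hy
  -- near `y` the hole chart is the translation by `c₀ ∂₀`
  have hloc : holeMap M a τ₀ =ᶠ[𝓝 y] fun z ↦ z + (M + 3) • E4.basisVector 0 := by
    filter_upwards [hN.mem_nhds ⟨hyU, hy0, hyr⟩] with z hz
    exact holeMap_eq_add_of_near hz.2.1.le hz.2.2.le
  have hfd : fderiv ℝ (holeMap M a τ₀) y = ContinuousLinearMap.id ℝ E4 := by
    rw [hloc.fderiv_eq]
    exact ((hasFDerivAt_id y).add_const _).fderiv
  have hd : DifferentiableAt ℝ (holeMap M a τ₀) y :=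
    (contDiffAt_holeMap ha hτ₀ (Kerr.radius_pos_of_mem_region hyU)).differentiableAt (by simp)
  have key := Spacetime.deviationExtend_coe (Kerr.spacetime M a r₁ hM) (Kerr.background M a)
    (holeChart M a r₁ τ₀ h) ⟨y, hyU⟩
  rw [Pi.zero_apply]
  refine key.trans ?_
  ext v w
  rw [deviation_of_repr hM (Kerr.background M a) (holeChart M a r₁ τ₀ h) (holeMap M a τ₀)
    (fun _ ↦ rfl) ⟨y, hyU⟩ hd, hfd, hloc.eq_of_nhds]
  change Kerr.bilin M a (y + (M + 3) • E4.basisVector 0) v w - Kerr.bilin M a y v w = 0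
  rw [Kerr.bilin_add_smul_basisVector_zero, sub_self]

/-- Consequently every derivative of the zero-extended deviation vanishes on the late near zone.
[folklore] -/
theorem iteratedFDeriv_deviationExtend_holeChart (ha : |a| < M) (hM : 0 ≤ M) (hτ₀ : 1 ≤ τ₀)
    (h : r₁ ≤ Kerr.rPlus M a) {x : E4} (hx : x ∈ Kerr.exterior M a) (hx0 : τ₀ < x 0)
    (hxr : Kerr.radius a x < 2 * nearR (x 0)) (m : ℕ) :
    iteratedFDeriv ℝ m ((Kerr.spacetime M a r₁ hM).deviationExtend (Kerr.background M a)
      (holeChart M a r₁ τ₀ h)) x = 0 := by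
  rw [((deviationExtend_holeChart_eventuallyEq_zero ha hM hτ₀ h hx hx0 hxr).iteratedFDeriv ℝ m).eq_of_nhds]
  simp

/-- **Near-zone convergence for free**: on the truncated slab `{t* = τ, r ≤ R'}` with `τ > τ₀` and
`R' < 2R(τ)` the `C²` deviation of the hole chart from Kerr is exactly `0`. [folklore] -/
theorem truncDeviationCk_holeChart_eq_zero (ha : |a| < M) (hM : 0 ≤ M) (hτ₀ : 1 ≤ τ₀)
    (h : r₁ ≤ Kerr.rPlus M a) {R' τ : ℝ} (hτ : τ₀ < τ) (hR' : R' < 2 * nearR τ) (k : ℕ) :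
    (Kerr.spacetime M a r₁ hM).truncDeviationCk (Kerr.background M a) (holeChart M a r₁ τ₀ h) k R' τ = 0 := by
  refine le_antisymm ?_ bot_le
  refine iSup₂_le fun m _ ↦ iSup₂_le fun y hy ↦ ?_
  obtain ⟨x, hx, rfl⟩ := hy
  obtain ⟨hx0, hxr⟩ := (ModelBackground.mem_truncTimeSlab).1 hx
  change (x : E4) 0 = τ at hx0
  change Kerr.radius a (x : E4) ≤ R' at hxr
  rw [iteratedFDeriv_deviationExtend_holeChart ha hM hτ₀ h x.2 (by rw [hx0]; exact hτ)
    (by rw [hx0]; linarith) m]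
  simp

/-- The near-zone deviation of the hole chart tends to `0` for every fixed radius `R'`. [folklore] -/
theorem tendsto_truncDeviationCk_holeChart (ha : |a| < M) (hM : 0 ≤ M) (hτ₀ : 1 ≤ τ₀)
    (h : r₁ ≤ Kerr.rPlus M a) (k : ℕ) (R' : ℝ) :
    Tendsto (fun τ ↦ (Kerr.spacetime M a r₁ hM).truncDeviationCk (Kerr.background M a)
      (holeChart M a r₁ τ₀ h) k R' τ) atTop (𝓝 0) := by
  refine tendsto_const_nhds.congr' ?_
  filter_upwards [eventually_gt_atTop (max τ₀ (R' ^ 2))] with τ hτ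
  have hτ0 : τ₀ < τ := lt_of_le_of_lt (le_max_left _ _) hτ
  have hR : R' < 2 * nearR τ := by
    have h1 : R' ^ 2 < τ := lt_of_le_of_lt (le_max_right _ _) hτ
    have h2 : |R'| < Real.sqrt τ := by
      rw [← Real.sqrt_sq_eq_abs]; exact Real.sqrt_lt_sqrt (sq_nonneg _) h1
    have h3 := le_abs_self R'
    rw [nearR]; linarith [Real.sqrt_nonneg τ]
  exact (truncDeviationCk_holeChart_eq_zero ha hM hτ₀ h hτ0 hR k).symm

/-- Along the growing near zone `R(τ) = √τ + 1` the deviation is eventually exactly `0`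
(clause (i) of `HasExhaustiveCharts` for the hole chart). [folklore] -/
theorem tendsto_truncDeviationCk_holeChart_nearR (ha : |a| < M) (hM : 0 ≤ M) (hτ₀ : 1 ≤ τ₀)
    (h : r₁ ≤ Kerr.rPlus M a) (k : ℕ) :
    Tendsto (fun τ ↦ (Kerr.spacetime M a r₁ hM).truncDeviationCk (Kerr.background M a)
      (holeChart M a r₁ τ₀ h) k (nearR τ) τ) atTop (𝓝 0) := by
  refine tendsto_const_nhds.congr' ?_
  filter_upwards [eventually_gt_atTop τ₀] with τ hτ
  have hR : nearR τ < 2 * nearR τ := by linarith [nearR_pos τ]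
  exact (truncDeviationCk_holeChart_eq_zero ha hM hτ₀ h hτ hR k).symm

/-! ## The flat chart: the deviation is the explicit bent-gauge function -/

/-- On the flat domain the zero-extended deviation of the flat chart from `η` is, near every point,
the explicit function of stub S6b (with `c₀ = M + 3`). [folklore] -/
theorem deviationExtend_flatChart_eventuallyEq (ha : |a| < M) (hM : 0 ≤ M)
    (hτ : Kerr.rPlus M a ≤ Real.sqrt τ₀) (h : r₁ ≤ Kerr.rPlus M a) (h0 : 0 < Kerr.rPlus M a)
    {x : E4} (hx : x ∈ flatDomain a τ₀) :
    (Kerr.spacetime M a r₁ hM).deviationExtend (Minkowski.backgroundOn (flatDomain a τ₀))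
        (flatChart M a r₁ τ₀ hτ h h0) =ᶠ[𝓝 x]
      fun x : E4 ↦
        (Kerr.bilin M a (x + ((M + 3) + bentHeight M a (Kerr.radius a x)) • E4.basisVector 0)).bilinearComp
            (ContinuousLinearMap.id ℝ E4 +
              (fderiv ℝ (fun y : E4 ↦ bentHeight M a (Kerr.radius a y)) x).smulRight (E4.basisVector 0))
            (ContinuousLinearMap.id ℝ E4 +
              (fderiv ℝ (fun y : E4 ↦ bentHeight M a (Kerr.radius a y)) x).smulRight (E4.basisVector 0))
          - Minkowski.bilin := by
  filter_upwards [(flatDomain a τ₀).2.mem_nhds hx] with y hy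
  have hr : 0 < Kerr.radius a y :=
    h0.trans (rPlus_lt_radius_of_mem_flatDomain hτ ⟨y, hy⟩)
  have hdS : DifferentiableAt ℝ (flatShift M a) y := (contDiffAt_flatShift ha hr).differentiableAt (by simp)
  have hD : HasFDerivAt (flatMap M a)
      (ContinuousLinearMap.id ℝ E4 + (fderiv ℝ (flatShift M a) y).smulRight (E4.basisVector 0)) y :=
    hasFDerivAt_timeShift hdS.hasFDerivAt
  have hfS : fderiv ℝ (flatShift M a) y = fderiv ℝ (fun z : E4 ↦ bentHeight M a (Kerr.radius a z)) y := by
    unfold flatShift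
    exact fderiv_const_add _
  have key := Spacetime.deviationExtend_coe (Kerr.spacetime M a r₁ hM)
    (Minkowski.backgroundOn (flatDomain a τ₀)) (flatChart M a r₁ τ₀ hτ h h0) ⟨y, hy⟩
  refine key.trans ?_
  ext v w
  rw [deviation_of_repr hM (Minkowski.backgroundOn (flatDomain a τ₀)) (flatChart M a r₁ τ₀ hτ h h0)
    (flatMap M a) (fun _ ↦ rfl) ⟨y, hy⟩ hD.differentiableAt, hD.fderiv, hfS]
  rfl

/-- **Radiation-zone convergence**: given the `C²` decay of the explicit bent-gauge deviation
(stub S6b, as a hypothesis), the `C²` deviation of the flat chart from `η` on the flat slabs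
`{x⁰ = τ} ∩ U₀ ⊆ {r > √τ}` tends to `0`. [folklore] -/
theorem tendsto_deviationCk_flatChart (ha : |a| < M) (hM : 0 ≤ M)
    (hτ : Kerr.rPlus M a ≤ Real.sqrt τ₀) (h : r₁ ≤ Kerr.rPlus M a) (h0 : 0 < Kerr.rPlus M a)
    (hdecay : ∀ ε : ℝ, 0 < ε → ∃ ρ₀ : ℝ, 0 < ρ₀ ∧ ∀ x : E4, ρ₀ ≤ Kerr.radius a x → ∀ m : ℕ, m ≤ 2 →
      ‖iteratedFDeriv ℝ m (fun x : E4 ↦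
          (Kerr.bilin M a (x + ((M + 3) + bentHeight M a (Kerr.radius a x)) • E4.basisVector 0)).bilinearComp
              (ContinuousLinearMap.id ℝ E4 +
                (fderiv ℝ (fun y : E4 ↦ bentHeight M a (Kerr.radius a y)) x).smulRight (E4.basisVector 0))
              (ContinuousLinearMap.id ℝ E4 +
                (fderiv ℝ (fun y : E4 ↦ bentHeight M a (Kerr.radius a y)) x).smulRight (E4.basisVector 0))
            - Minkowski.bilin) x‖ ≤ ε) :
    Tendsto (fun τ ↦ (Kerr.spacetime M a r₁ hM).deviationCk (Minkowski.backgroundOn (flatDomain a τ₀))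
      (flatChart M a r₁ τ₀ hτ h h0) 2 τ) atTop (𝓝 0) := by
  rw [ENNReal.tendsto_nhds_zero]
  intro ε hε
  rcases eq_or_ne ε ⊤ with rfl | hεtop
  · exact Eventually.of_forall fun _ ↦ le_top
  have hεr : 0 < ε.toReal := ENNReal.toReal_pos hε.ne' hεtop
  obtain ⟨ρ₀, hρ₀, hρ⟩ := hdecay ε.toReal hεr
  filter_upwards [eventually_ge_atTop (ρ₀ ^ 2)] with τ hτ'
  refine iSup₂_le fun m hm ↦ iSup₂_le fun y hy ↦ ?_
  obtain ⟨x, hx, rfl⟩ := hy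
  have hx0 : (x : E4) 0 = τ := hx
  have hrad : ρ₀ ≤ Kerr.radius a (x : E4) := by
    have h1 : Real.sqrt ((x : E4) 0) < Kerr.radius a (x : E4) := x.2.2
    have h2 : ρ₀ ≤ Real.sqrt τ := by
      rw [show ρ₀ = Real.sqrt (ρ₀ ^ 2) from (Real.sqrt_sq hρ₀.le).symm]
      exact Real.sqrt_le_sqrt hτ'
    rw [hx0] at h1; linarith
  rw [((deviationExtend_flatChart_eventuallyEq ha hM hτ h h0 x.2).iteratedFDeriv ℝ m).eq_of_nhds,
    ← ofReal_norm, ← ENNReal.ofReal_toReal hεtop]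
  exact ENNReal.ofReal_le_ofReal (hρ _ hrad m hm)

end Deviation


/-- **Registered helper stub** (S6a part D): the deviation of a chart of the Kerr spacetime with an `E4`
representative, from any background on the chart's domain. [folklore] -/
theorem _root_.Summit.FinalStateConjecture.FinalStateConjecture.Theorems.SwallowTheDatum.KerrShieldedSettles.stub_kerrExteriorDecompositionDeviations :
    ∀ [Kerr.Facts] {M a r₁ : ℝ} (hM : 0 ≤ M) (B : ModelBackground) (Ψ : B.domain → Kerr.region a r₁)
      (Φ : E4 → E4), (∀ y : B.domain, (Ψ y : E4) = Φ y) → ∀ (x : B.domain), DifferentiableAt ℝ Φ x →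
      ∀ (v w : E4), (Kerr.spacetime M a r₁ hM).deviation B Ψ x v w =
        Kerr.bilin M a (Φ x) (fderiv ℝ Φ x v) (fderiv ℝ Φ x w) - B.bilin x.1 v w :=
  fun hM B Ψ Φ hΦ x hd v w ↦ deviation_of_repr hM B Ψ Φ hΦ x hd v w

end ExteriorDecomposition

end Summit.FinalStateConjecture.FinalStateConjecture.Theorems.SwallowTheDatum.KerrShieldedSettles

end
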